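import Literature.AnabelianGeometry.EtaleTheta.SettingModelKummerCocycleP
import Literature.AnabelianGeometry.EtaleTheta.SettingModelKummerCocycleQTate
import HarnessLib

/-!
# The Tate-module dictionary for the STAGE-2 pair `(κ_p², χ)`: on `E_{p²}[N](ℚ̄_p)`, in the basis
# `P₁ = φ(ξ_N)`, `P₂ = φ((p^{1/N})²)`, every `σ ∈ G_{ℚ_p}` acts by `(χ_N(σ) (κ_p(σ)² mod N); 0 1)`
# (R78 cluster of the abc-iut cell, file F3d-2; arithmetic cross-check of "`k = 2κ(q̈) = κ(q_X)`")

J. Silverman, *Advanced Topics in the Arithmetic of Elliptic Curves* (1994), proof of Prop. V.6.1 (PDF p. 411):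
`P₂^σ = P₂ + i·P₁` when `Q^σ = ζ_N^i Q` for `Q` an `N`-th root of `q` [cite: SilvermanATAEC1994, proof of Prop. V.6.1 (PDF p. 411)];
S. Mochizuki, *The étale theta function …*, Publ. RIMS **45** (2009) [EtTh], §1 p. 17: `K̈ = K(ζ₂, q_X^{1/2})`, the square
root `q̈` of the `q`-parameter (model: `q_X = p²`, `q̈ = p`) [cite: MochizukiEtTh2009, §1 p.17].

abc-iut cell, layer L2, seat abc-iut-L2-t5 (gen 5).  PROOF-ONLY sequel (0 definitions) of F3d
(`SettingModelKummerCocycleQTate`) for the root system `qRootsOfP p` of `q = p²` made of the SQUARES of the chosen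
roots `pRoots p` of `q̈ = p` (F3c-2, `SettingModelKummerCocycleP`): the `N`-th root of `q` entering the Tate basis is
now `Q := (p^{1/N})²`, and the connecting cocycle is `κ_p²` — abc-iut-L2-t12's "`[k] = 2·κ(q̈) = κ(q_X)`" (STATUS
06:59:06Z), the `k`-coordinate of `cocyclePairHom p Φ hΦ i 2`:

* `smul_qRootsOfP_root_div_eq_pow` — `σ • Q / Q = ξ_N ^ (κ_p(σ)² mod N)` on units;
* `exists_tateTorsionBasis_chi_kappaP_sq` — basis `P₁, P₂` of `E_{p²}[N](ℚ̄_p)` with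
  **`σ • P₁ = χ_N(σ) • P₁`** and **`σ • P₂ = P₂ + (κ_p(σ)² mod N) • P₁`** for every `σ ∈ G_{ℚ_p}`;
* `mem_ker_galoisRepTorsion_tateCurve_iff_chi_kappaP` — `σ` acts trivially on `E_{p²}[N]` iff `χ_N(σ) = 1` and
  `κ_p(σ)² ≡ 0 (mod N)` (for odd `N` equivalently `κ_p(σ) ≡ 0`; for even `N` the `2`-torsion of `ℤ/N` is the familiar
  `K_N ⊊ K̈_N` phenomenon of [EtTh] §1 p. 17 — not pursued here).

Classical and undisputed; a model is consistency evidence only; nothing here bears on [IUTchIII] Cor. 3.12.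
-/

noncomputable section

open CategoryTheory ProfiniteGrp ProfiniteGrp.ProfiniteCompletion

namespace Literature.AnabelianGeometry.EtaleTheta.SettingModel

open Literature.AnabelianGeometry.SemiGraphs (GQp)
open Literature.NumberTheory.EllipticCurves Literature.NumberTheory.EllipticCurves.TateCurve
open Literature.NumberTheory.EllipticCurves.SteinWuthrich2013 (tateCurve)
open WeierstrassCurve Field

variable (p : ℕ) [Fact p.Prime]

/-- `Q := (p^{1/N})²` raised to `N` is the image of `p² ∈ ℚ_pˣ` (hypothesis shape `hQ` of the lineage's
`exists_basis_kummer_galoisRepTorsion_tateCurve`). [cite: MochizukiEtTh2009, §1 p.17] -/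
theorem qRootsOfP_root_pow_eq_map (N : ℕ+) :
    (qRootsOfP p).root N ^ ((N : ℕ) : ℕ) =
      Units.map (algebraMap ℚ_[p] (AlgebraicClosure ℚ_[p]) : ℚ_[p] →* AlgebraicClosure ℚ_[p])
        (Units.mk0 _ (natCast_sq_ne_zero p)) := by
  rw [(qRootsOfP p).pow_self, qUnit_eq_map_mk0]

/-- `σ • Q / Q = ξ_N ^ (κ_p(σ)² mod N)` for `Q = (p^{1/N})²`: the Kummer cocycle of the square root system is `κ_p²`
(F3c-2's `kummerZH_qRootsOfP`) read through the discrete logarithm (`cycGen_pow_level`). [cite: NeukirchANT1999, Ch. IV §3] -/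
theorem smul_qRootsOfP_root_div_eq_pow (σ : GQp p) (N : ℕ+) :
    σ • (qRootsOfP p).root N / (qRootsOfP p).root N =
      (cycGen p : ℕ+ → (PadicAlgCl p)ˣ) N ^ (Multiplicative.toAdd (ZHatLevel.level N (kappaP p σ ^ 2))).val := by
  rw [← kummerZH_qRootsOfP p σ, kummerZH_def,
    ← kummerCocycle_top_apply (qRootsOfP p) (mem_fixedPoints_top_of_forall (smul_qUnit p)) σ N]
  exact (cycGen_pow_level p _ N).symm

/-- **The Tate-module dictionary for the stage-2 pair `(κ_p², χ)`.**  For every `N ≥ 1` there is a basis `P₁, P₂` of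
`E_{p²}[N](ℚ̄_p)` (generation + relations) — `P₁ = φ(ξ_N)`, `P₂ = φ((p^{1/N})²)` for the CHOSEN `ξ_N = cycGen p N`,
`p^{1/N} = pRoot p N` and the Tate uniformisation `φ` — on which every `σ ∈ G_{ℚ_p}` acts by
`σ • P₁ = χ_N(σ) • P₁` and `σ • P₂ = P₂ + (κ_p(σ)² mod N) • P₁`: the matrix `(χ_N(σ) k_N(σ); 0 1)` with `k = κ_p²`
the `k`-coordinate of F3c-2's `cocyclePairHom p Φ hΦ i 2`. [cite: SilvermanATAEC1994, proof of Prop. V.6.1 (PDF p. 411)] -/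
theorem exists_tateTorsionBasis_chi_kappaP_sq (N : ℕ+) :
    ∃ P₁ P₂ : geomPoints (tateCurve ((((p : ℕ) : ℚ_[p]) ^ 2 : ℚ_[p]))),
      ((N : ℕ) : ℤ) • P₁ = 0 ∧ ((N : ℕ) : ℤ) • P₂ = 0 ∧
      (∀ P : geomPoints (tateCurve ((((p : ℕ) : ℚ_[p]) ^ 2 : ℚ_[p]))), ((N : ℕ) : ℤ) • P = 0 →
        ∃ a b : ℤ, P = a • P₁ + b • P₂) ∧
      (∀ a b : ℤ, a • P₁ + b • P₂ = 0 ↔ ((N : ℕ) : ℤ) ∣ a ∧ ((N : ℕ) : ℤ) ∣ b) ∧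
      ∀ σ : GQp p,
        (absoluteGaloisGroup.toAlgEquiv ℚ_[p]).symm σ • P₁ = (ZHatLevel.levelChar N (chi p σ)).val • P₁ ∧
        (absoluteGaloisGroup.toAlgEquiv ℚ_[p]).symm σ • P₂ =
          P₂ + (Multiplicative.toAdd (ZHatLevel.level N (kappaP p σ ^ 2))).val • P₁ := by
  obtain ⟨P₁, P₂, h1, h2, hgen, hrel, hchi, hkum⟩ :=
    exists_basis_kummer_galoisRepTorsion_tateCurve (K := ℚ_[p]) (Units.mk0 _ (natCast_sq_ne_zero p))
      (norm_natCast_sq_lt_one p) N.pos (isPrimitiveRoot_coe_cycGen p N) (qRootsOfP_root_pow_eq_map p N)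
  refine ⟨P₁, P₂, h1, h2, hgen, hrel, fun σ => ⟨?_, ?_⟩⟩
  · refine hchi _ _ ?_
    rw [MulEquiv.apply_symm_apply]
    exact smul_cycGen_apply_eq_pow p σ N
  · have h := hkum ((absoluteGaloisGroup.toAlgEquiv ℚ_[p]).symm σ)
      (Multiplicative.toAdd (ZHatLevel.level N (kappaP p σ ^ 2))).val
      (by rw [MulEquiv.apply_symm_apply]; exact smul_qRootsOfP_root_div_eq_pow p σ N)
    rwa [sub_eq_iff_eq_add'] at h

/-- The square root in the field: `Q = (p^{1/N})²`, `Q^N = p²`. [cite: MochizukiEtTh2009, §1 p.17] -/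
theorem pRoot_sq_pow (N : ℕ+) : (pRoot p N ^ 2) ^ (N : ℕ) = (((p : ℕ) : PadicAlgCl p) ^ 2) := by
  rw [← pow_mul, mul_comm, pow_mul, pRoot_pow]

/-- `level N (κ_p(σ)²) = 1 ↔ σ` fixes `Q = (p^{1/N})²`. [cite: NeukirchANT1999, Ch. IV §3] -/
theorem level_kappaP_sq_eq_one_iff (σ : GQp p) (N : ℕ+) :
    ZHatLevel.level N (kappaP p σ ^ 2) = 1 ↔ σ (pRoot p N ^ 2) = pRoot p N ^ 2 := by
  rw [← kummerZH_qRootsOfP p σ, level_kummerZH_eq_one_iff, qRootsOfP_root, Units.val_mul, coe_pRoots_root, sq]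

/-- **`σ` acts trivially on `E_{p²}[N](ℚ̄_p)` iff `χ_N(σ) = 1 ∧ κ_p(σ)² ≡ 0 (mod N)`** (the lineage's
`mem_ker_galoisRepTorsion_tateCurve_iff_of_roots` at `ξ_N` and `Q = (p^{1/N})²`).
[cite: SilvermanATAEC1994, Thm. V.3.1 (c),(d) (PDF pp. 395–399)] -/
theorem mem_ker_galoisRepTorsion_tateCurve_iff_chi_kappaP (N : ℕ+) (σ : GQp p) :
    (absoluteGaloisGroup.toAlgEquiv ℚ_[p]).symm σ ∈
        (galoisRepTorsion (tateCurve ((((p : ℕ) : ℚ_[p]) ^ 2 : ℚ_[p]))) ((N : ℕ) : ℤ)).ker ↔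
      ZHatLevel.levelChar N (chi p σ) = 1 ∧ ZHatLevel.level N (kappaP p σ ^ 2) = 1 := by
  have hQ : (pRoot p N ^ 2) ^ (N : ℕ) = algebraMap ℚ_[p] (AlgebraicClosure ℚ_[p]) ((((p : ℕ) : ℚ_[p]) ^ 2 : ℚ_[p])) := by
    rw [pRoot_sq_pow, map_pow, map_natCast]
  rw [mem_ker_galoisRepTorsion_tateCurve_iff_of_roots _ (natCast_sq_ne_zero p) (norm_natCast_sq_lt_one p)
    N.pos (isPrimitiveRoot_coe_cycGen p N) hQ, levelChar_chi_eq_one_iff, level_kappaP_sq_eq_one_iff,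
    absoluteGaloisGroup.smul_def, absoluteGaloisGroup.smul_def, MulEquiv.apply_symm_apply]

/-- Consequently the two level-`N` kernels agree: `κ_q(σ) ≡ 0 ↔ κ_p(σ)² ≡ 0 (mod N)` given `χ_N(σ) = 1` — both are
"`σ` fixes `E_{p²}[N]`" (F3d's `mem_ker_galoisRepTorsion_tateCurve_iff_chi_kappaQ`), although the cocycles `κ_q`
and `κ_p²` themselves differ by a coboundary (F3c-2's `kappaQ_eq_kappaP_sq_mul_coboundary`).
[cite: SilvermanATAEC1994, Thm. V.3.1 (c),(d) (PDF pp. 395–399)] -/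
theorem level_kappaQ_eq_one_iff_level_kappaP_sq_eq_one {σ : GQp p} {N : ℕ+}
    (hχ : ZHatLevel.levelChar N (chi p σ) = 1) :
    ZHatLevel.level N (kappaQ p σ) = 1 ↔ ZHatLevel.level N (kappaP p σ ^ 2) = 1 := by
  have h1 := mem_ker_galoisRepTorsion_tateCurve_iff_chi_kappaQ p N σ
  have h2 := mem_ker_galoisRepTorsion_tateCurve_iff_chi_kappaP p N σ
  rw [h1] at h2
  constructor
  · intro h; exact (h2.mp ⟨hχ, h⟩).2
  · intro h; exact (h2.mpr ⟨hχ, h⟩).2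

end Literature.AnabelianGeometry.EtaleTheta.SettingModel

end
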